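import Summits.HodgeConjecture.HodgeConjecture.Theses.BiquadraticSecantLift
import Summits.HodgeConjecture.HodgeConjecture.Theorems.BiquadraticSecantLiftDiscriminantSplit
import Summits.HodgeConjecture.HodgeConjecture.Theorems.BiquadraticSecantLiftDiscriminantSign
import Summits.HodgeConjecture.HodgeConjecture.Theorems.BiquadraticSecantLiftKaehler
import Summits.HodgeConjecture.HodgeConjecture.Theorems.BiquadraticSecantLiftHyperbolicTransport
import Literature.AlgebraicGeometry.Deligne1982.HyperbolicOfSplitDiscriminantCMKaehler
import Literature.AlgebraicGeometry.Deligne1982.ProductPolarizationKaehlerCM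
import Literature.AlgebraicGeometry.HodgeTheory.PowSuccProductCone
import Literature.AlgebraicGeometry.HodgeTheory.DivisorLefschetzGroupCentreFiniteIntrinsic
import Literature.AlgebraicGeometry.Motives.RationalDegreeOneModel
import HarnessLib

/-!
# BiquadraticSecantLift · X2 `BiquadraticBaseChangeHyperbolic` — PROVED

Closes crux X2 (stmt-HodgeConjecture-22133) of route-HodgeConjecture-BiquadraticSecantLift: for a Weil-type
sixfold `(A, φ)`, `φ² = -d` (`d ≥ 1`), carrying a non-zero Weil–Hodge class, there is a non-square `m ≥ 1` such that
`(A ⊞ A, η = (φ ⊕ φ) ≫ (𝟙 + ψ_m))` is of HYPERBOLIC Weil type relative to the biquadratic CM field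
`L = ℚ[T]/(R_(d,m)(T²)) = ℚ(√-d, √m)` (`HodgeTheory.IsHyperbolicWeilTypeCM (A ⊞ A) η R_(d,m) 2 3`).

Proof (Deligne 1982, §4–5; van Geemen 1994, §5): on `B = ⨁_{Fin 2} A ≅ A ⊞ A` take the `K`-symmetrised
two-embedding class `k = d κ + φ^*κ`, `κ = ι₀^*(e^*a) + ι₁^*(e^*a)` on `A` and `h₂ = π₀^*k + m π₁^*k` on `B`
(rational, Kähler multiples, Rosati = complex conjugation for `φ`, resp. `η`). Deligne's discriminant of
`(A, φ, k)` relative to `K = ℚ(√-d)` is a rational `q₀` with `(-1)³ q₀ > 0` (Hodge–Riemann, (4.5));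
writing `-q₀ = a/b` we take `m = 2` if `adb` is a square and `m = adb` otherwise, so that `-q₀ = d v²` with
`v ∈ F = ℚ(√m)`; then the discriminant of `(B, η, h₂)` relative to `L` is the split class `[(-1)³]`, and Landherr's
criterion (Deligne Cor. 4.2, `isHyperbolicWeilType_of_hasWeilDiscriminantCM_split_of_isKaehlerClass_smul`) gives an
`η^*`-stable rational Lagrangian. Finally everything is transported to `A ⊞ A` along `biprodIsoTwelvefold`.

This is NOT a case of the Hodge conjecture: HC is NOT proved here (X2 is one crux of one route).

## References
[cite: Deligne1982HodgeCycles, §4 (4.5), Cor. 4.2, Lemma 4.6, §5 (c) p. 39] [cite: vanGeemen1994HodgeAV, §5 (5.2–5.4)]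
[cite: Landherr1936HermitianForms] [cite: Milne1999LefschetzClasses, §1]
-/

-- every declaration of this problem lives in `Summit.HodgeConjecture.HodgeConjecture.…` (summit = sub-problem)
set_option linter.dupNamespace false

noncomputable section

open CategoryTheory CategoryTheory.Limits Polynomial Module
open Literature.AlgebraicTopology.SingularHomology Literature.Geometry.Kaehler
open Literature.AlgebraicGeometry.HodgeTheory
open Literature.AlgebraicGeometry.Motives (AbelianVariety IsSmoothProjective polarizationPairingOne ProjectiveEmbedding)
open Literature.AlgebraicGeometry.Milne1999 (sumPolarizationClass)
open Literature.AlgebraicGeometry.VanGeemen1994 (pullbackOne)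
open Literature.AlgebraicGeometry.Deligne1982

namespace Summit.HodgeConjecture.HodgeConjecture.BiquadraticSecantLift

variable {A : AbelianVariety ℂ} {φ : A ⟶ A} {d m : ℕ}

/-- `2` is not a square. -/
theorem not_isSquare_two : ¬ IsSquare (2 : ℕ) := by
  rintro ⟨r, hr⟩
  have h : r ≤ 2 := by nlinarith
  interval_cases r <;> omega

/-- **`⨁_{Fin 2} A` is of hyperbolic Weil type relative to `L`**, from: the Weil-type datum `(A, φ)` over `K`,
a rational class `k` with `φ^*k = d k` and a Kähler multiple, a Kähler multiple of `h₂ = π₀^*k + m π₁^*k`, an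
`A`-side discriminant witness `(x, ω_A = t_A L(k), c, Φ, q₀)`, and `v ∈ F` with `d v² = -q₀`. -/
theorem isHyperbolicWeilTypeCM_twelvefold (hd : 0 < d) (hm : ¬ IsSquare m) (hφ : φ ≫ φ = -(d • 𝟙 A))
    (hWA : IsWeilTypeCM A φ (X + C (d : ℤ)) 1 3) (hirrK : Irreducible (cmPolyQ (X + C (d : ℤ))))
    {k : complexBetti A.X 2} (hQk : IsRationalClass k) (hk : complexBetti.map φ.hom.hom.hom 2 k = (d : ℂ) • k)
    (hKk : ∃ s : ℝ, s ≠ 0 ∧ IsKaehlerClass A.dim A.X ((s : ℂ) • k))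
    (hK2 : ∃ s : ℝ, s ≠ 0 ∧ IsKaehlerClass (twelvefold A).dim (twelvefold A).X
      ((s : ℂ) • sumPolarizationClass (fun _ : Fin 2 => A) ![k, (m : ℂ) • k]))
    {x : Fin (2 * 3) → complexBetti A.X 1} {ωA : complexBetti A.X (2 + 2 * (A.dim - 1))}
    {c : Fin (2 * 3) → Fin (2 * 3) → Fin (2 * 1) → ℚ} {Φ : Matrix (Fin (2 * 3)) (Fin (2 * 3)) (cmField (X + C (d : ℤ)))}
    {q₀ tA : ℚ} (htA : tA ≠ 0) (hq0 : q₀ ≠ 0) (hx : ∀ b, IsRationalClass (x b))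
    (hli : LinearIndependent ℂ (fun p : Fin (2 * 1) × Fin (2 * 3) => (pullbackOne A φ ^ (p.1 : ℕ)) (x p.2)))
    (hωA : ωA = ((tA : ℚ) : ℂ) • lefschetzPow k (A.dim - 1) 2 k)
    (hQx : ∀ (a b : Fin (2 * 3)) (j : Fin (2 * 1)),
      polarizationPairingOne A.X k (A.dim - 1) ((pullbackOne A φ ^ (j : ℕ)) (x a)) (x b) = ((c a b j : ℚ) : ℂ) • ωA)
    (htr : ∀ (a b : Fin (2 * 3)) (j : Fin (2 * 1)),
      Algebra.trace ℚ (cmField (X + C (d : ℤ))) (cmRoot (X + C (d : ℤ)) ^ (j : ℕ) * Φ a b) = c a b j)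
    (hq : AdjoinRoot.of (cmPolyQ (X + C (d : ℤ))) q₀ = cmRoot (X + C (d : ℤ)) ^ 6 * Φ.det)
    {v : realField (bqPoly d m)}
    (hv : (d : realField (bqPoly d m)) * v ^ 2 = AdjoinRoot.of (realPolyQ (bqPoly d m)) (-q₀)) :
    IsHyperbolicWeilTypeCM (twelvefold A) (etaTwo A φ m) (bqPoly d m) 2 3 := by
  have hm0 : m ≠ 0 := ne_zero_of_not_isSquare hm
  have hmC : (m : ℂ) ≠ 0 := Nat.cast_ne_zero.2 hm0
  have hWB : IsWeilTypeCM (twelvefold A) (etaTwo A φ m) (bqPoly d m) 2 3 := isWeilTypeCM_twelvefold hWA hm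
  have hirrL : Irreducible (cmPolyQ (bqPoly d m)) := hWB.irreducible
  haveI hFL : Fact (Irreducible (realPolyQ (bqPoly d m))) := hWB.fact_irreducible_map_real
  have h2 := hWA.two_le_dim
  have hApos : 0 < A.dim := by omega
  have hAeq : A.dim = A.dim - 1 + 1 := by omega
  -- Rosati for `k` on `A`, polarization, `L(k) ≠ 0`
  have hrosk : ∀ x y : complexBetti A.X 1,
      polarizationPairingOne A.X k (A.dim - 1) (complexBetti.map φ.hom.hom.hom 1 x) y =
        -polarizationPairingOne A.X k (A.dim - 1) x (complexBetti.map φ.hom.hom.hom 1 y) :=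
    fun x y ↦ polarizationPairingOne_map_left_of_map_eq_smul hAeq hd hφ hk x y
  have hpolk : IsPolarizationClass A.dim A.X k := isPolarizationClass_of_isKaehlerClass_smul hQk hKk
  have hLk : lefschetzPow k (A.dim - 1) 2 k ≠ 0 :=
    Literature.AlgebraicGeometry.Motives.AbelianVariety.lefschetzPow_self_ne_zero_of_hasHardLefschetzProperty
      (by omega) hpolk.hasHardLefschetz
  -- the class `h₂` on `B`
  have hQ2 : IsRationalClass (sumPolarizationClass (fun _ : Fin 2 => A) ![k, (m : ℂ) • k]) :=
    isRationalClass_sumPolarizationClass_two hQk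
  have hpol2 : IsPolarizationClass (twelvefold A).dim (twelvefold A).X
      (sumPolarizationClass (fun _ : Fin 2 => A) ![k, (m : ℂ) • k]) :=
    isPolarizationClass_of_isKaehlerClass_smul hQ2 hK2
  have hB1 : 1 ≤ (twelvefold A).dim := by rw [dim_twelvefold]; omega
  have hLB := Literature.AlgebraicGeometry.Motives.AbelianVariety.lefschetzPow_self_ne_zero_of_hasHardLefschetzProperty
    hB1 hpol2.hasHardLefschetz
  have hros2 : ∀ u w : complexBetti (twelvefold A).X 1,
      polarizationPairingOne (twelvefold A).X (sumPolarizationClass (fun _ : Fin 2 => A) ![k, (m : ℂ) • k])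
          ((twelvefold A).dim - 1) (pullbackOne (twelvefold A) (etaTwo A φ m) u) w =
        -polarizationPairingOne (twelvefold A).X (sumPolarizationClass (fun _ : Fin 2 => A) ![k, (m : ℂ) • k])
          ((twelvefold A).dim - 1) u (pullbackOne (twelvefold A) (etaTwo A φ m) w) :=
    fun u w ↦ rosati_etaTwo hApos hmC hLk hrosk u w
  -- the discriminant of `(B, η, h₂)` is split
  have hdisc := hasWeilDiscriminantCM_twelvefold_split hd hm hφ hirrL hirrK hApos hQk hLB htA hq0 hx hli hωA hQx htr hq hv
  -- Landherr
  haveI : Fact (Irreducible (cmPolyQ (bqPoly d m))) := ⟨hirrL⟩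
  have hhyp : Literature.AlgebraicGeometry.Motives.IsHyperbolicWeilType (twelvefold A) (etaTwo A φ m) (3 * 2)
      (sumPolarizationClass (fun _ : Fin 2 => A) ![k, (m : ℂ) • k]) :=
    isHyperbolicWeilType_of_hasWeilDiscriminantCM_split_of_isKaehlerClass_smul hWB hQ2 hros2 hK2 hdisc
  exact IsHyperbolicWeilTypeCM.intro' hWB _ hpol2 hros2 hdisc hhyp

/-- **X2 `BiquadraticBaseChangeHyperbolic` (stmt-HodgeConjecture-22133), proved.** See the module docstring.
HC is NOT proved by this theorem. -/
theorem biquadraticBaseChangeHyperbolic_proof :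
    Summit.HodgeConjecture.HodgeConjecture.Theses.BiquadraticSecantLift.BiquadraticBaseChangeHyperbolic := by
  intro d hd A φ hA6 hφ hw
  classical
  -- ### the Weil-type datum `(A, φ)` over `K = ℚ(√-d)`
  have hWA : IsWeilTypeCM A φ (X + C (d : ℤ)) 1 3 := isWeilTypeCM_quadratic_of_weilClass hd hA6 hφ hw
  haveI hFK : Fact (Irreducible (realPolyQ (X + C (d : ℤ)))) := hWA.fact_irreducible_map_real
  have hirrK : Irreducible (cmPolyQ (X + C (d : ℤ))) := hWA.irreducible
  have hApos : 0 < A.dim := by rw [hA6]; norm_num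
  have hAeq : A.dim = A.dim - 1 + 1 := by omega
  -- ### the two-embedding class `k = d κ + φ^* κ`
  obtain ⟨e, a, ha, ha0, -⟩ := exists_segreEmbedding_powSucc (twelvefold A)
  set κ : complexBetti A.X 2 :=
    complexBetti.map (biproduct.ι (fun _ : Fin 2 => A) 0).hom.hom.hom 2 (complexBetti.map e.ι 2 a) +
      complexBetti.map (biproduct.ι (fun _ : Fin 2 => A) 1).hom.hom.hom 2 (complexBetti.map e.ι 2 a) with hκ
  set k : complexBetti A.X 2 := (d : ℂ) • κ + complexBetti.map φ.hom.hom.hom 2 κ with hkdef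
  have hκK : ∃ t : ℝ, t ≠ 0 ∧ IsKaehlerClass A.dim A.X ((t : ℂ) • κ) :=
    exists_isKaehlerClass_smul_restrictions A hApos e ha ha0
  have hKk : ∃ t : ℝ, t ≠ 0 ∧ IsKaehlerClass A.dim A.X ((t : ℂ) • k) := exists_isKaehlerClass_smul_ksymm φ hd hκK
  have hQκ : IsRationalClass κ :=
    (isRationalClass_complexBetti_map _ (isRationalClass_complexBetti_map _ ha)).add
      (isRationalClass_complexBetti_map _ (isRationalClass_complexBetti_map _ ha))
  have hQk : IsRationalClass k := by
    have h1 := hQκ.smul (d : ℚ)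
    rw [Rat.cast_natCast] at h1
    exact h1.add (isRationalClass_complexBetti_map _ hQκ)
  have hk : complexBetti.map φ.hom.hom.hom 2 k = (d : ℂ) • k := map_ksymm_eq_smul' hφ κ
  have hrosk : ∀ x y : complexBetti A.X 1,
      polarizationPairingOne A.X k (A.dim - 1) (pullbackOne A φ x) y =
        -polarizationPairingOne A.X k (A.dim - 1) x (pullbackOne A φ y) :=
    fun x y ↦ polarizationPairingOne_map_left_of_map_eq_smul hAeq hd hφ hk x y
  have hpolk : IsPolarizationClass A.dim A.X k := isPolarizationClass_of_isKaehlerClass_smul hQk hKk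
  have hLk : lefschetzPow k (A.dim - 1) 2 k ≠ 0 :=
    Literature.AlgebraicGeometry.Motives.AbelianVariety.lefschetzPow_self_ne_zero_of_hasHardLefschetzProperty
      (by omega) hpolk.hasHardLefschetz
  -- ### Deligne's discriminant of `(A, φ, k)` relative to `K`: a rational `q₀` with `(-1)³ q₀ > 0`
  obtain ⟨δ, x, ωA, c, Φ, q, hx, hli, hωArat, hωA0, hQx, htr, hdet, -⟩ := exists_hasWeilDiscriminantCM hWA hQk hKk hrosk
  have h1 : Module.finrank ℂ (complexBetti A.X (2 + 2 * (A.dim - 1))) = 1 :=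
    Literature.AlgebraicGeometry.Motives.finrank_complexBetti_two_add_two_mul_eq_one
      (Literature.AlgebraicGeometry.Motives.isSmoothProjective_of_dim_eq' hAeq)
  obtain ⟨tA, htA⟩ := Literature.AlgebraicGeometry.Motives.exists_eq_ratCast_smul_of_finrank_eq_one h1
    (HodgeRiemannDegreeOne.IsRationalClass.lefschetzPow hQk _ hQk) hLk hωArat
  have htA0 : tA ≠ 0 := by
    rintro rfl
    exact hωA0 (by rw [htA, Rat.cast_zero, zero_smul])
  obtain ⟨q₀, hq₀⟩ := exists_eq_algebraMap_realField_quadratic d (q : realField (X + C (d : ℤ)))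
  rw [AdjoinRoot.algebraMap_eq] at hq₀
  have hq' : AdjoinRoot.of (cmPolyQ (X + C (d : ℤ))) q₀ = cmRoot (X + C (d : ℤ)) ^ (2 * 3) * Φ.det := by
    rw [← hdet, hq₀, algebraMap_realField_eq, realToCM_of, AdjoinRoot.algebraMap_eq]
  have hq0 : q₀ ≠ 0 := fun h0 ↦ q.ne_zero (by rw [hq₀, h0, map_zero])
  haveI hFKc : Fact (Irreducible (cmPolyQ (X + C (d : ℤ)))) := ⟨hirrK⟩
  have hsign := neg_one_pow_mul_ratDisc_pos hd hWA hQk hrosk hKk hx hωArat hωA0 hQx htr hq0 hq'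
  have hneg : 0 < -q₀ := by linarith [hsign, show (-1 : ℚ) ^ 3 * q₀ = -q₀ by ring]
  -- ### `-q₀ = a/b`; the choice of `m` and of `v ∈ F` with `d v² = -q₀`
  set r : ℚ := -q₀ with hr
  have hab : ((r.num.natAbs : ℕ) : ℚ) / r.den = -q₀ := by
    have hnum : ((r.num.natAbs : ℕ) : ℤ) = r.num := Int.natAbs_of_nonneg (Rat.num_nonneg.2 hneg.le)
    have hnum' : ((r.num.natAbs : ℕ) : ℚ) = (r.num : ℚ) := by rw [← Int.cast_natCast (R := ℚ) r.num.natAbs, hnum]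
    rw [hnum', Rat.num_div_den r]
  have hchoice : ∃ m : ℕ, ¬ IsSquare m ∧ ∃ v : realField (bqPoly d m),
      (d : realField (bqPoly d m)) * v ^ 2 = AdjoinRoot.of (realPolyQ (bqPoly d m)) (-q₀) := by
    by_cases hsq : IsSquare (r.num.natAbs * d * r.den)
    · have hW2 := isWeilTypeCM_twelvefold hWA not_isSquare_two
      obtain ⟨v, hv⟩ := exists_mul_sq_eq_of_isSquare d 2 hW2.irreducible_map_real hd r.den_pos hsq
      exact ⟨2, not_isSquare_two, v, by rw [hv, hab]⟩
    · have hWm := isWeilTypeCM_twelvefold hWA hsq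
      obtain ⟨v, hv⟩ := exists_mul_sq_eq_of_eq d (r.num.natAbs * d * r.den) hWm.irreducible hWm.irreducible_map_real
        hd r.den_pos rfl
      exact ⟨_, hsq, v, by rw [hv, hab]⟩
  obtain ⟨m, hm, v, hv⟩ := hchoice
  have hm0 : m ≠ 0 := ne_zero_of_not_isSquare hm
  have hm1 : m ≠ 1 := ne_one_of_not_isSquare hm
  have hm2 : 2 ≤ m := by omega
  refine ⟨m, Nat.pos_of_ne_zero hm0, hm, ?_⟩
  -- ### Kähler multiple of `h₂ = π₀^* k + m π₁^* k` on `B = ⨁_{Fin 2} A`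
  have hK2 : ∃ s : ℝ, s ≠ 0 ∧ IsKaehlerClass (twelvefold A).dim (twelvefold A).X
      ((s : ℂ) • sumPolarizationClass (fun _ : Fin 2 => A) ![k, (m : ℂ) • k]) := by
    rw [sumPolarizationClass_two_eq]
    exact exists_isKaehlerClass_smul_prodClass hApos φ hd hm2 e ha ha0
  -- ### hyperbolic Weil type of `⨁_{Fin 2} A`, then of `A ⊞ A`
  have hq6 : AdjoinRoot.of (cmPolyQ (X + C (d : ℤ))) q₀ = cmRoot (X + C (d : ℤ)) ^ 6 * Φ.det := hq'
  have hB : IsHyperbolicWeilTypeCM (twelvefold A) (etaTwo A φ m) (bqPoly d m) 2 3 :=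
    isHyperbolicWeilTypeCM_twelvefold hd hm hφ hWA hirrK hQk hk hKk hK2 htA0 hq0 hx hli htA hQx htr hq6 hv
  exact isHyperbolicWeilTypeCM_of_iso (biprodIsoTwelvefold A) (etaBiprod_comp_biprodIsoTwelvefold_hom A φ m) hB

end Summit.HodgeConjecture.HodgeConjecture.BiquadraticSecantLift
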